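import Summits.QuantumFields.YangMills.Theorems.BalabanLadderUVSeamRecWindowFloorsTwoPointRatio
import Summits.QuantumFields.YangMills.Theorems.BalabanLadderUVSeamRecWindowFloorsThreePointParamRatio
import Summits.QuantumFields.YangMills.Theorems.BalabanLadderUVSeamRecWindowFloors
import Summits.QuantumFields.YangMills.Theorems.BalabanLadderUVSeamRecWindowTransfer
import Summits.QuantumFields.YangMills.Theorems.LangevinControlUVOSLegsAtWeakCouplingCFblOfFbl6
import Summits.QuantumFields.YangMills.Theorems.BalabanLadderUVSeamRecUnitTransfer
import HarnessLib

/-!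
# Crux `UVSeamRec` (stmt-QuantumFields-20043), floors side: scale-window floors — ARBITRARY comparability windows

Helper file (`--supports stmt-QuantumFields-20043`) of the lead prover (unit `ym-spine-20043-p1`); `κ`-general edition of
`BalabanLadderUVSeamRecWindowFloors` (there the comparability window had width factor 2): ANY bounded two-sided window
`c₁ ≤ a β / u β ≤ c₂` (`0 < c₁ ≤ c₂`) eventually now suffices — the honest F-C′ «engine unit two-loop-commensurate with the
unit of record up to bounded factors», no ceilings, no convergence:

* `windowFloors_threePoint_ratio` — window `t ∈ [κ, 1]`, any `κ > 0` (from `threePoint_floor_param_ratio`);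
* `windowFloors_of_fcp_ratio` — both window conjuncts over `[κ, 1]`;
* `lowerBounds_of_fcp_window_ratio` — `FBL ∧ FC2 ∧ FC3` at `a` with `κ ≤ a β / u β ≤ 1` eventually ⇒ `LowerBounds G r u`;
* `lowerBounds_of_fcp_commensurable'` — any window `c₁ ≤ a β / u β ≤ c₂` (`0 < c₁ ≤ c₂`), by exact dilation to the unit `c₂·u`;
* `lowerBounds_uRec_of_femtoCommensurable` — `Statement.stub_fcp6` + `TwoPointPinned ∧ Skewness` at a unit `a` with
  `c₁ ≤ a/uRec ≤ c₂` eventually ⇒ `LowerBounds G r uRec`; `stubFloors_of_femtoCommensurable` in the skeleton's `SU(2)` shape.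
-/

set_option autoImplicit false

noncomputable section

open scoped SchwartzMap
open MeasureTheory Filter Topology Metric
open Literature.MathematicalPhysics.QuantumFieldTheory Literature.MathematicalPhysics.QuantumLattice
open Literature.MathematicalPhysics.AQFT Literature.Probability.LatticeModels
open Summit.QuantumFields.YangMills.Theorems.OSLegsFromFemtoAndGap.StubLower
open Summit.QuantumFields.YangMills.Cruxes.OSLegsFromFemtoAndGap.DlrCollarTransfer

namespace Summit.QuantumFields.YangMills.Cruxes.UVSeamRec.WindowFloors

section Window

variable (G : Type) [Group G] [TopologicalSpace G] [IsTopologicalGroup G] [CompactSpace G]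
  [MeasurableSpace G] [BorelSpace G] (r : LatticeRep G) (a : ℝ → ℝ)

/-- **Scale-window three-point floors, ratio `κ`**: from `FBL ∧ FC2 ∧ FC3` at `a > 0`, `a → 0`, ONE triple of compactly
supported, pairwise disjoint bumps `f, g, h` floors the connected three-point function at EVERY smearing scale `a β / t`,
`t ∈ [κ, 1]`, uniformly. [folklore] -/
theorem windowFloors_threePoint_ratio {κ : ℝ} (hκ : 0 < κ) (hapos : ∀ β, 0 < a β) (hlim : Tendsto a atTop (𝓝 0))
    (hFBL : FBL G r a) (hFC2 : FC2 G r a) (hFC3 : FC3 G r a) :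
    ∃ (f g h : 𝓢(EuclideanSpace ℝ (Fin 4), ℝ)) (ε β₅ Λ₅ : ℝ),
      HasCompactSupport (f : EuclideanSpace ℝ (Fin 4) → ℝ) ∧ HasCompactSupport (g : EuclideanSpace ℝ (Fin 4) → ℝ) ∧
      HasCompactSupport (h : EuclideanSpace ℝ (Fin 4) → ℝ) ∧
      Disjoint (tsupport (f : EuclideanSpace ℝ (Fin 4) → ℝ)) (tsupport (g : EuclideanSpace ℝ (Fin 4) → ℝ)) ∧
      Disjoint (tsupport (g : EuclideanSpace ℝ (Fin 4) → ℝ)) (tsupport (h : EuclideanSpace ℝ (Fin 4) → ℝ)) ∧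
      Disjoint (tsupport (f : EuclideanSpace ℝ (Fin 4) → ℝ)) (tsupport (h : EuclideanSpace ℝ (Fin 4) → ℝ)) ∧ 0 < ε ∧
      ∀ t ∈ Set.Icc κ 1, ∀ β : ℝ, β₅ ≤ β → ∀ L : ℕ, Λ₅ ≤ a β * L →
        ε ≤ |Q3 G r β L (a β / t) f g h| := by
  obtain ⟨v, w, δ, s, ε, β₅, Λ₅, hδ, h2v, h2w, h2vw, hs0, hε, H⟩ :=
    threePoint_floor_param_ratio G r a hκ hapos hlim hFBL hFC2 hFC3
  -- the master triple of bumps at scale `s`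
  have hρ : 0 < δ * s / 8 := by positivity
  obtain ⟨f, hf0, -, hfone, hfsupp, hfts⟩ :=
    exists_bump_schwartz (0 : EuclideanSpace ℝ (Fin 4)) (ρ := δ * s / 8) hρ
  obtain ⟨g, hg0, -, hgone, hgsupp, hgts⟩ := exists_bump_schwartz (s • v) (ρ := δ * s / 8) hρ
  obtain ⟨h, hh0, -, hhone, hhsupp, hhts⟩ := exists_bump_schwartz (s • w) (ρ := δ * s / 8) hρ
  refine ⟨f, g, h, ε, β₅, Λ₅, ?_, ?_, ?_, ?_, ?_, ?_, hε, fun t ht β hβ L hL => ?_⟩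
  · rw [HasCompactSupport, hfts]; exact isCompact_closedBall _ _
  · rw [HasCompactSupport, hgts]; exact isCompact_closedBall _ _
  · rw [HasCompactSupport, hhts]; exact isCompact_closedBall _ _
  · rw [hfts, hgts]
    refine closedBall_disjoint_closedBall ?_
    rw [dist_eq_norm, zero_sub, norm_neg, norm_smul, Real.norm_eq_abs, abs_of_pos hs0]
    have := mul_lt_mul_of_pos_left (show δ / 2 < ‖v‖ by linarith only [h2v, hδ]) hs0
    linarith only [this]
  · rw [hgts, hhts]
    refine closedBall_disjoint_closedBall ?_
    rw [dist_eq_norm, ← smul_sub, norm_smul, Real.norm_eq_abs, abs_of_pos hs0]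
    have := mul_lt_mul_of_pos_left (show δ / 2 < ‖v - w‖ by linarith only [h2vw, hδ]) hs0
    linarith only [this]
  · rw [hfts, hhts]
    refine closedBall_disjoint_closedBall ?_
    rw [dist_eq_norm, zero_sub, norm_neg, norm_smul, Real.norm_eq_abs, abs_of_pos hs0]
    have := mul_lt_mul_of_pos_left (show δ / 2 < ‖w‖ by linarith only [h2w, hδ]) hs0
    linarith only [this]
  -- dilate the triple by `t⁻¹`: bumps at scale `t·s ∈ [κs, s]`
  obtain ⟨htlo, hthi⟩ := ht
  have ht0 : 0 < t := by linarith
  obtain ⟨Dl, hDl⟩ := UnitDilation.exists_dilation t⁻¹ (inv_ne_zero ht0.ne')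
  have hQ : Q3 G r β L (a β / t) f g h =
      Q3 G r β L (a β) (SchwartzMap.compCLMOfContinuousLinearEquiv ℝ Dl f)
        (SchwartzMap.compCLMOfContinuousLinearEquiv ℝ Dl g) (SchwartzMap.compCLMOfContinuousLinearEquiv ℝ Dl h) := by
    rw [UnitDilation.Q3_compCLM Dl t⁻¹ hDl]
    congr 1
    field_simp
  rw [hQ]
  have hts : t * s ∈ Set.Icc (κ * s) s := ⟨mul_le_mul_of_nonneg_right htlo hs0.le, by nlinarith⟩
  have ht8 : t⁻¹ * (δ * (t * s) / 8) = δ * s / 8 := by field_simp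
  -- plateau / support data of a dilated bump
  have hplat : ∀ (q : 𝓢(EuclideanSpace ℝ (Fin 4), ℝ)) (p : EuclideanSpace ℝ (Fin 4)),
      (∀ z, dist z (s • p) ≤ δ * s / 8 → q z = 1) →
      ∀ z, dist z ((t * s) • p) ≤ δ * (t * s) / 8 → SchwartzMap.compCLMOfContinuousLinearEquiv ℝ Dl q z = 1 := by
    intro q p hq z hz
    rw [SchwartzMap.compCLMOfContinuousLinearEquiv_apply, Function.comp_apply, hDl]
    refine hq _ ?_
    rw [dist_inv_smul t ht0, smul_smul]
    calc t⁻¹ * dist z ((t * s) • p) ≤ t⁻¹ * (δ * (t * s) / 8) := mul_le_mul_of_nonneg_left hz (inv_pos.2 ht0).le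
      _ = δ * s / 8 := ht8
  have hsupp : ∀ (q : 𝓢(EuclideanSpace ℝ (Fin 4), ℝ)) (p : EuclideanSpace ℝ (Fin 4)),
      (∀ z, q z ≠ 0 → dist z (s • p) < 2 * (δ * s / 8)) →
      ∀ z, SchwartzMap.compCLMOfContinuousLinearEquiv ℝ Dl q z ≠ 0 → dist z ((t * s) • p) < 2 * (δ * (t * s) / 8) := by
    intro q p hq z hz
    rw [SchwartzMap.compCLMOfContinuousLinearEquiv_apply, Function.comp_apply, hDl] at hz
    have h1 := hq _ hz
    rw [dist_inv_smul t ht0, smul_smul] at h1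
    have h2 : t⁻¹ * dist z ((t * s) • p) < t⁻¹ * (2 * (δ * (t * s) / 8)) := by
      calc t⁻¹ * dist z ((t * s) • p) < 2 * (δ * s / 8) := h1
        _ = t⁻¹ * (2 * (δ * (t * s) / 8)) := by rw [← ht8]; ring
    exact lt_of_mul_lt_mul_left h2 (inv_pos.2 ht0).le
  have hnn : ∀ (q : 𝓢(EuclideanSpace ℝ (Fin 4), ℝ)), (∀ z, 0 ≤ q z) →
      ∀ z, 0 ≤ SchwartzMap.compCLMOfContinuousLinearEquiv ℝ Dl q z := by
    intro q hq z
    rw [SchwartzMap.compCLMOfContinuousLinearEquiv_apply, Function.comp_apply]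
    exact hq _
  -- centre `0 = s • 0 = (t s) • 0`
  have hf1 : ∀ z, dist z (s • (0 : EuclideanSpace ℝ (Fin 4))) ≤ δ * s / 8 → f z = 1 := by
    intro z hz; rw [smul_zero] at hz; exact hfone z hz
  have hf2 : ∀ z, f z ≠ 0 → dist z (s • (0 : EuclideanSpace ℝ (Fin 4))) < 2 * (δ * s / 8) := by
    intro z hz; rw [smul_zero]; exact hfsupp z hz
  refine H (t * s) hts _ _ _ (hnn f hf0) (fun z hz => hplat f 0 hf1 z (by rwa [smul_zero])) (fun z hz => ?_)
    (hnn g hg0) (hplat g v hgone) (hsupp g v hgsupp) (hnn h hh0) (hplat h w hhone) (hsupp h w hhsupp) β hβ L hL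
  have := hsupp f 0 hf2 z hz
  rwa [smul_zero] at this

/-- **Scale-window floors from the frozen-boundary femto package, ratio `κ`**: both window conjuncts of
`WindowTransfer.lowerBounds_of_window` with window `[κ, 1]`, from `FBL ∧ FC2 ∧ FC3` at `a > 0`, `a → 0`. [folklore] -/
theorem windowFloors_of_fcp_ratio {κ : ℝ} (hκ : 0 < κ) (hapos : ∀ β, 0 < a β) (hlim : Tendsto a atTop (𝓝 0))
    (hFBL : FBL G r a) (hFC2 : FC2 G r a) (hFC3 : FC3 G r a) :
    (∃ (v : 𝓢(EuclideanSpace ℝ (Fin 4), ℝ)) (ε β₅ Λ₅ : ℝ),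
      tsupport (v : EuclideanSpace ℝ (Fin 4) → ℝ) ⊆ {y : EuclideanSpace ℝ (Fin 4) | 0 < y 0} ∧ 0 < ε ∧
      ∀ t ∈ Set.Icc κ 1, ∀ β : ℝ, β₅ ≤ β → ∀ L : ℕ, Λ₅ ≤ a β * L →
        ε ≤ Q2 G r β L (a β / t) (thetaTest 4 v) v) ∧
    (∃ (f g h : 𝓢(EuclideanSpace ℝ (Fin 4), ℝ)) (ε β₅ Λ₅ : ℝ),
      Disjoint (tsupport (f : EuclideanSpace ℝ (Fin 4) → ℝ)) (tsupport (g : EuclideanSpace ℝ (Fin 4) → ℝ)) ∧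
      Disjoint (tsupport (g : EuclideanSpace ℝ (Fin 4) → ℝ)) (tsupport (h : EuclideanSpace ℝ (Fin 4) → ℝ)) ∧
      Disjoint (tsupport (f : EuclideanSpace ℝ (Fin 4) → ℝ)) (tsupport (h : EuclideanSpace ℝ (Fin 4) → ℝ)) ∧ 0 < ε ∧
      ∀ t ∈ Set.Icc κ 1, ∀ β : ℝ, β₅ ≤ β → ∀ L : ℕ, Λ₅ ≤ a β * L → ε ≤ |Q3 G r β L (a β / t) f g h|) := by
  obtain ⟨v, ε, β₅, Λ₅, -, hv, hε, H2⟩ := windowFloors_twoPoint_ratio G r a hκ hapos hlim hFBL hFC2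
  obtain ⟨f, g, h, ε', β₅', Λ₅', -, -, -, hfg, hgh, hfh, hε', H3⟩ :=
    windowFloors_threePoint_ratio G r a hκ hapos hlim hFBL hFC2 hFC3
  exact ⟨⟨v, ε, β₅, Λ₅, hv, hε, H2⟩, ⟨f, g, h, ε', β₅', Λ₅', hfg, hgh, hfh, hε', H3⟩⟩

/-- **Floors at a commensurate unit from the femto package, window `[κ, 1]`** (no ceilings, no ratio convergence). [folklore] -/
theorem lowerBounds_of_fcp_window_ratio {u : ℝ → ℝ} {κ : ℝ} (hκ : 0 < κ) (hapos : ∀ β, 0 < a β)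
    (hlim : Tendsto a atTop (𝓝 0)) (hu : ∀ β, 0 < u β) (hwin : ∀ᶠ β in atTop, κ ≤ a β / u β ∧ a β / u β ≤ 1)
    (hFBL : FBL G r a) (hFC2 : FC2 G r a) (hFC3 : FC3 G r a) : LowerBounds G r u := by
  obtain ⟨h2, h3⟩ := windowFloors_of_fcp_ratio G r a hκ hapos hlim hFBL hFC2 hFC3
  exact WindowTransfer.lowerBounds_of_window r hκ hu hwin h2 h3

/-- **Floors at a commensurate unit from the femto package, ANY bounded two-sided window** `c₁ ≤ a β / u β ≤ c₂` eventually
(`0 < c₁ ≤ c₂`), by exact dilation to the target unit `c₂ · u` (`UnitDilation.lowerBounds_of_const_mul`) and the window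
`[c₁/c₂, 1]`.  NO ceilings, NO ratio convergence. [folklore] -/
theorem lowerBounds_of_fcp_commensurable' {u : ℝ → ℝ} {c₁ c₂ : ℝ} (hc₁ : 0 < c₁) (hc₁₂ : c₁ ≤ c₂) (hapos : ∀ β, 0 < a β)
    (hlim : Tendsto a atTop (𝓝 0)) (hu : ∀ β, 0 < u β)
    (hwin : ∀ᶠ β in atTop, c₁ ≤ a β / u β ∧ a β / u β ≤ c₂)
    (hFBL : FBL G r a) (hFC2 : FC2 G r a) (hFC3 : FC3 G r a) : LowerBounds G r u := by
  have hc₂ : 0 < c₂ := hc₁.trans_le hc₁₂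
  -- floors at the unit `c₂ · u`, for which `a / (c₂ u) ∈ [c₁/c₂, 1]`
  have hu' : ∀ β, 0 < c₂ * u β := fun β => mul_pos hc₂ (hu β)
  have hwin' : ∀ᶠ β in atTop, c₁ / c₂ ≤ a β / (c₂ * u β) ∧ a β / (c₂ * u β) ≤ 1 := by
    filter_upwards [hwin] with β hβ
    obtain ⟨h1, h2⟩ := hβ
    have huβ := hu β
    have e : a β / (c₂ * u β) = a β / u β / c₂ := by
      field_simp
    rw [e]
    exact ⟨div_le_div_of_nonneg_right h1 hc₂.le, (div_le_one hc₂).2 h2⟩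
  have h := lowerBounds_of_fcp_window_ratio G r a (div_pos hc₁ hc₂) hapos hlim hu' hwin' hFBL hFC2 hFC3
  exact UnitDilation.lowerBounds_of_const_mul r hc₂ h

/-- **Floors at the unit of record from the femto line, ANY commensurability window**: `IsCompactSimpleLieGroup G`,
`Statement.stub_fcp6`, the femto packages `TwoPointPinned ∧ Skewness` of `r` at a unit `a` with `c₁ ≤ a β / uRec β ≤ c₂`
eventually (`0 < c₁ ≤ c₂`) give `LowerBounds G r uRec` — NO ceilings, NO convergence of `a/uRec`. [folklore] -/
theorem lowerBounds_uRec_of_femtoCommensurable (hG : IsCompactSimpleLieGroup G) (hfcp : Statement.stub_fcp6) {c₁ c₂ : ℝ}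
    (hc₁ : 0 < c₁) (hc₁₂ : c₁ ≤ c₂)
    (hwin : ∀ᶠ β in atTop, c₁ ≤ a β / Transport.uRec β ∧ a β / Transport.uRec β ≤ c₂)
    (hTP : TwoPointPinned G r a) (hSk : Skewness G r a) : LowerBounds G r Transport.uRec := by
  obtain ⟨hFBL6, hFC2, hFC3⟩ := hfcp G hG r a hTP hSk
  obtain ⟨Γ, β₀, ℓ₀, c', C, -, -, hpos, hlim, -⟩ := hTP
  exact lowerBounds_of_fcp_commensurable' G r a hc₁ hc₁₂ hpos hlim UnitTransfer.uRec_pos hwin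
    (fbl_of_fbl6 r a hFBL6) hFC2 hFC3

end Window

/-- **The floors stub from NT's femto line at a commensurate unit** (skeleton shape, `SU(2)` Borel): `IsCompactSimpleLieGroup SU(2)`,
`Statement.stub_fcp6` and ONE lattice representation of `SU(2)` with `TwoPointPinned ∧ Skewness` at a unit `a` with
`c₁ ≤ a/uRec ≤ c₂` eventually (`0 < c₁ ≤ c₂`; «two-loop scaling of the engine unit up to BOUNDED factors») ⇒ the conclusion
of the registered floors obligation `∃ r, LowerBounds SU(2) r uRec`.  Neither ceilings nor `UV` are consumed. [folklore] -/
theorem stubFloors_of_femtoCommensurable (hSU2 : IsCompactSimpleLieGroup (Matrix.specialUnitaryGroup (Fin 2) ℂ))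
    (hfcp : Statement.stub_fcp6)
    (heng : letI : MeasurableSpace (Matrix.specialUnitaryGroup (Fin 2) ℂ) := borel _
      haveI : BorelSpace (Matrix.specialUnitaryGroup (Fin 2) ℂ) := ⟨rfl⟩
      ∃ (r : LatticeRep (Matrix.specialUnitaryGroup (Fin 2) ℂ)) (a : ℝ → ℝ) (c₁ c₂ : ℝ), 0 < c₁ ∧ c₁ ≤ c₂ ∧
        (∀ᶠ β in atTop, c₁ ≤ a β / Transport.uRec β ∧ a β / Transport.uRec β ≤ c₂) ∧
        TwoPointPinned (Matrix.specialUnitaryGroup (Fin 2) ℂ) r a ∧ Skewness (Matrix.specialUnitaryGroup (Fin 2) ℂ) r a) :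
    letI : MeasurableSpace (Matrix.specialUnitaryGroup (Fin 2) ℂ) := borel _
    haveI : BorelSpace (Matrix.specialUnitaryGroup (Fin 2) ℂ) := ⟨rfl⟩
    ∃ r : LatticeRep (Matrix.specialUnitaryGroup (Fin 2) ℂ),
      LowerBounds (Matrix.specialUnitaryGroup (Fin 2) ℂ) r Transport.uRec := by
  letI : MeasurableSpace (Matrix.specialUnitaryGroup (Fin 2) ℂ) := borel _
  haveI : BorelSpace (Matrix.specialUnitaryGroup (Fin 2) ℂ) := ⟨rfl⟩
  obtain ⟨r, a, c₁, c₂, hc₁, hc₁₂, hwin, hTP, hSk⟩ := heng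
  exact ⟨r, lowerBounds_uRec_of_femtoCommensurable _ r a hSU2 hfcp hc₁ hc₁₂ hwin hTP hSk⟩

end Summit.QuantumFields.YangMills.Cruxes.UVSeamRec.WindowFloors

end
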